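import Mathlib
import HarnessLib
import Summits.HubbardSuperconductivity.HubbardSuperconductivity.Theorems.KLProgrammeKLRegimeSplitTwoLegAngularGraded

/-!
# Route `KLProgramme` — the frame-side (E3g) constants in CLOSED FORM: regime thresholds `klCurveC3 R`, `klCurveU0 R`, the graded
# curve constant `klCurveC0 R`, the (E3g) threshold `klAngU0 R Mtot`, and the explicit forms of `fermiPointLp_graded_of_frameOK` /
# `twoLegAngularG_of_graded_sizes`

Cell `gate-hubbard-kl`, seat hubbard-kl-k3c3-p3 (g3; row «implicit-function / monotonicity route»).  For the ENGINE child's two-leg stubs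
(stmt-HubbardSuperconductivity-19855: `stub_twoLeg_scale0` / `stub_twoLeg_step` conclude `TwoLegStepV12 … n` ∋ (E3g) under the package's
FIXED thresholds `c ≤ klEngC₀3 P R`, `U ≤ klEngU₀3 P R c`).  The regime theorems of k3c3-p3 g2/g3 (`fermiPointLp_graded_of_frameOK`
p480072, `twoLegAngularG_of_graded_sizes/_moments`) quantify `∃ c₃ U₀ C₀`; a stub taker cannot compare an opaque `∃` with the package's
numerals.  This module NAMES the witnesses (functions of `R`, of the moment constant `Mtot`, and of the window's transversality constant
`cDtmin (-1.1) (-0.1)` only — no `β, U, c, K, θ, L, M`) so that the package author can `min` them in by name: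

* `klCurveKappa = min (cDtmin (-1.1) (-0.1)) (1/5)`, `klCurveC3 R = κ/(12(Gfr₂+1))`, `klCurveU0 R = min 1 (κ/(24(Gfr₀+Gfr₁+1)))`
  (p4's `frame_thresholds` witnesses), `klCurveR1 … klCurveR4 R` (the tower majorants of g2's proof with `d = cDtmin/2`, `s = π√2`;
  `R3` affine in `Gfr₃`, `R4` affine in `Gfr₃, Gfr₄`), `klCurveC0 R = 20·max(1, R1, R2, R3, R4)`, `klAngU0 R Mtot = min (klCurveU0 R)
  (1/(Mtot·klCurveC0 R⁴ + 1))`;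
* `frame_sizes_of_frameOK_explicit`, `fermiPointLp_graded_of_frameOK_explicit` (`‖Dⁱ(toLp ∘ k_F^K)‖ ≤ (klCurveC0 R·2^{nScales β+1})ⁱ`,
  `1 ≤ i ≤ 4`, and `C⁴`), `twoLegAngularG_of_graded_sizes_explicit` / `_moments_explicit` ((E3g) with NO `∃`: for `0 < c ≤ klCurveC3 R`,
  `0 < U ≤ klAngU0 R Mtot`, graded sizes `≤ Mtot·U²·2^{k(N+1)}` ⟹ `TwoLegAngularG`).

Definitions of real constants + proofs; nothing is asserted about the Hubbard model.  References: BGM 2006 §2.4 (2.40)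
[cite: BenfattoGiulianiMastropietro2006]; HOME/prover-p1b/g5/E3-CERT-NOTE.md §5 (a) (the `c`-free majorant request).
-/

noncomputable section

namespace Summit.HubbardSuperconductivity.HubbardSuperconductivity.Theorems.PerturbedFermiCurve

set_option linter.dupNamespace false -- summit = problem name (single-conjunct summit), D-0017

open Real Set Finset
open Literature.MathematicalPhysics.QuantumLattice Literature.MathematicalPhysics.QuantumLattice.BandSectorCounting
open Literature.Probability.LatticeModels Literature.MathematicalPhysics.QuantumLattice.FermiRG
open Summit.HubbardSuperconductivity.HubbardSuperconductivity.Theorems.DispersionFlow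
open Summit.HubbardSuperconductivity.HubbardSuperconductivity.Theorems.KLRegimeSplit

/-! ## §1 The named constants -/

/-- The regime margin `κ = min(Dt_min, 1/5)` of the window `[-1.1, -0.1]` (`Dt_min = cDtmin (-1.1) (-0.1)`). -/
def klCurveKappa : ℝ := min (cDtmin (-1.1) (-0.1)) (1 / 5)

/-- The `c`-threshold `κ/(12(Gfr₂+1))` below which `4A ≤ κ` (p4's `frame_thresholds` witness). -/
def klCurveC3 (R : RenConsts) : ℝ := klCurveKappa / (12 * (R.Gfr 2 + 1))

/-- The `U`-threshold `min 1 (κ/(24(Gfr₀+Gfr₁+1)))` below which `4A ≤ κ` (p4's `frame_thresholds` witness). -/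
def klCurveU0 (R : RenConsts) : ℝ := min 1 (klCurveKappa / (24 * (R.Gfr 0 + R.Gfr 1 + 1)))

/-- Half the transversality constant: the worst-case denominator `d = Dt_min/2 ≤ Dt_min − 2A`. -/
def klCurveD : ℝ := cDtmin (-1.1) (-0.1) / 2

/-- Order-1 tower majorant `R1 = (4 + 1/10)·π√2/d`. -/
def klCurveR1 : ℝ := (4 + 1 / 10) * (π * Real.sqrt 2) / klCurveD

/-- Order-2 tower majorant `R2 = ((4+1/5)(R1+s)² + (4+1/10)(2R1+s))/d`, `s = π√2`. -/
def klCurveR2 : ℝ :=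
  ((4 + 1 / 5) * (klCurveR1 + π * Real.sqrt 2) ^ 2 + (4 + 1 / 10) * (2 * klCurveR1 + π * Real.sqrt 2)) / klCurveD

/-- Order-3 tower majorant (coefficient of `4^{N+1}`), affine in `Gfr₃`. -/
def klCurveR3 (R : RenConsts) : ℝ :=
  ((4 + 8 * R.Gfr 3) * (klCurveR1 + π * Real.sqrt 2) ^ 3 +
      3 * (4 + 1 / 5) * (klCurveR1 + π * Real.sqrt 2) * (klCurveR2 + 2 * klCurveR1 + π * Real.sqrt 2) +
      (4 + 1 / 10) * (3 * klCurveR2 + 3 * klCurveR1 + π * Real.sqrt 2)) / klCurveD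

/-- Order-4 tower majorant (coefficient of `16^{N+1}`), affine in `Gfr₃` and `Gfr₄`. -/
def klCurveR4 (R : RenConsts) : ℝ :=
  ((4 + 16 * R.Gfr 4) * (klCurveR1 + π * Real.sqrt 2) ^ 4 +
      6 * (4 + 8 * R.Gfr 3) * (klCurveR1 + π * Real.sqrt 2) ^ 2 * (klCurveR2 + 2 * klCurveR1 + π * Real.sqrt 2) +
      3 * (4 + 1 / 5) * (klCurveR2 + 2 * klCurveR1 + π * Real.sqrt 2) ^ 2 +
      4 * (4 + 1 / 5) * (klCurveR1 + π * Real.sqrt 2) * (klCurveR3 R + 3 * klCurveR2 + 3 * klCurveR1 + π * Real.sqrt 2) +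
      (4 + 1 / 10) * (4 * klCurveR3 R + 6 * klCurveR2 + 4 * klCurveR1 + π * Real.sqrt 2)) / klCurveD

/-- **The graded curve constant** `C₀(R) = 20·max(1, R1, R2, R3(R), R4(R))`: `‖Dⁱ(toLp ∘ k_F^K)‖ ≤ (C₀(R)·2^{N+1})ⁱ` for admissible frames. -/
def klCurveC0 (R : RenConsts) : ℝ := 20 * max 1 (max klCurveR1 (max klCurveR2 (max (klCurveR3 R) (klCurveR4 R))))

/-- **The (E3g) threshold** `min (klCurveU0 R) (1/(Mtot·C₀(R)⁴ + 1))`: below it the graded fit against the frozen `angBar` holds. -/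
def klAngU0 (R : RenConsts) (Mtot : ℝ) : ℝ := min (klCurveU0 R) (1 / (Mtot * klCurveC0 R ^ 4 + 1))

/-! ## §2 Elementary facts about the constants -/

/-- `0 < Dt_min` on the window (the `Dtmin_pos` field of `bandBounds`). -/
theorem cDtmin_window_pos : 0 < cDtmin (-1.1) (-0.1) :=
  (bandBounds (show (-4 : ℝ) < -1.1 by norm_num) (show (-1.1 : ℝ) ≤ -0.1 by norm_num) (show (-0.1 : ℝ) < 0 by norm_num)).Dtmin_pos

/-- `0 < κ`. -/
theorem klCurveKappa_pos : 0 < klCurveKappa := lt_min cDtmin_window_pos (by norm_num)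

/-- `κ ≤ Dt_min`. -/
theorem klCurveKappa_le_cDtmin : klCurveKappa ≤ cDtmin (-1.1) (-0.1) := min_le_left _ _

/-- `κ ≤ 1/5`. -/
theorem klCurveKappa_le_fifth : klCurveKappa ≤ 1 / 5 := min_le_right _ _

/-- `0 < klCurveC3 R`. -/
theorem klCurveC3_pos {R : RenConsts} (hR : ∀ j, 0 ≤ R.Gfr j) : 0 < klCurveC3 R := by
  have := hR 2; have := klCurveKappa_pos; unfold klCurveC3; positivity

/-- `0 < klCurveU0 R`. -/
theorem klCurveU0_pos {R : RenConsts} (hR : ∀ j, 0 ≤ R.Gfr j) : 0 < klCurveU0 R := by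
  have := hR 0; have := hR 1; have := klCurveKappa_pos; unfold klCurveU0
  exact lt_min one_pos (by positivity)

/-- `klCurveU0 R ≤ 1`. -/
theorem klCurveU0_le_one (R : RenConsts) : klCurveU0 R ≤ 1 := min_le_left _ _

/-- `0 < d`. -/
theorem klCurveD_pos : 0 < klCurveD := by
  have := cDtmin_window_pos; unfold klCurveD; positivity

/-- `0 ≤ R1`. -/
theorem klCurveR1_nonneg : 0 ≤ klCurveR1 := by
  have := klCurveD_pos; unfold klCurveR1; positivity

/-- `0 ≤ R2`. -/
theorem klCurveR2_nonneg : 0 ≤ klCurveR2 := by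
  have := klCurveD_pos; have := klCurveR1_nonneg; unfold klCurveR2; positivity

/-- `0 ≤ R3`. -/
theorem klCurveR3_nonneg {R : RenConsts} (hR : ∀ j, 0 ≤ R.Gfr j) : 0 ≤ klCurveR3 R := by
  have := klCurveD_pos; have := klCurveR1_nonneg; have := klCurveR2_nonneg; have := hR 3; unfold klCurveR3; positivity

/-- `0 ≤ R4`. -/
theorem klCurveR4_nonneg {R : RenConsts} (hR : ∀ j, 0 ≤ R.Gfr j) : 0 ≤ klCurveR4 R := by
  have := klCurveD_pos; have := klCurveR1_nonneg; have := klCurveR2_nonneg; have := klCurveR3_nonneg hR; have := hR 3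
  have := hR 4; unfold klCurveR4; positivity

/-- `1 ≤ C₀(R)`. -/
theorem one_le_klCurveC0 (R : RenConsts) : 1 ≤ klCurveC0 R := by
  unfold klCurveC0
  have : (1 : ℝ) ≤ max 1 (max klCurveR1 (max klCurveR2 (max (klCurveR3 R) (klCurveR4 R)))) := le_max_left _ _
  linarith

/-- `0 < klAngU0 R Mtot`. -/
theorem klAngU0_pos {R : RenConsts} (hR : ∀ j, 0 ≤ R.Gfr j) {Mtot : ℝ} (hMtot : 0 ≤ Mtot) : 0 < klAngU0 R Mtot := by
  have hU := klCurveU0_pos hR; have hC := one_le_klCurveC0 R; unfold klAngU0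
  exact lt_min hU (by positivity)

/-- `klAngU0 R Mtot ≤ klCurveU0 R`. -/
theorem klAngU0_le_klCurveU0 (R : RenConsts) (Mtot : ℝ) : klAngU0 R Mtot ≤ klCurveU0 R := min_le_left _ _

/-- Below `klAngU0 R Mtot` the smallness `Mtot·C₀(R)⁴·U ≤ 1` of `graded_fit_angBar` holds. -/
theorem smallness_of_le_klAngU0 {R : RenConsts} {Mtot U : ℝ} (hMtot : 0 ≤ Mtot) (hU : U ≤ klAngU0 R Mtot) :
    Mtot * klCurveC0 R ^ 4 * U ≤ 1 := by
  have h0 : 0 ≤ Mtot * klCurveC0 R ^ 4 := by have := one_le_klCurveC0 R; positivity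
  have hden : 0 < Mtot * klCurveC0 R ^ 4 + 1 := by linarith
  have hU' : U ≤ 1 / (Mtot * klCurveC0 R ^ 4 + 1) := hU.trans (min_le_right _ _)
  calc Mtot * klCurveC0 R ^ 4 * U ≤ Mtot * klCurveC0 R ^ 4 * (1 / (Mtot * klCurveC0 R ^ 4 + 1)) :=
        mul_le_mul_of_nonneg_left hU' h0
    _ = Mtot * klCurveC0 R ^ 4 / (Mtot * klCurveC0 R ^ 4 + 1) := by ring
    _ ≤ 1 := by rw [div_le_one hden]; linarith

/-- **The explicit thresholds do their job** (p4's `frame_thresholds`, constants named): for `0 ≤ c ≤ klCurveC3 R` and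
`0 < U ≤ klCurveU0 R`, `4·(2Gfr₀|U| + 2Gfr₁U² + Gfr₂·c/log 4) ≤ κ`. -/
theorem frame_thresholds_explicit {R : RenConsts} (hR : ∀ j, 0 ≤ R.Gfr j) {c U : ℝ} (hc : 0 ≤ c) (hcle : c ≤ klCurveC3 R)
    (hU : 0 < U) (hUle : U ≤ klCurveU0 R) :
    4 * (2 * R.Gfr 0 * |U| + 2 * R.Gfr 1 * U ^ 2 + R.Gfr 2 * (c / Real.log 4)) ≤ klCurveKappa := by
  have h0 := hR 0; have h1 := hR 1; have h2 := hR 2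
  have hκ := klCurveKappa_pos
  have hlog : 1 ≤ Real.log 4 := by
    have h4 : Real.exp 1 ≤ 4 := by have := Real.exp_one_lt_d9; norm_num at this; linarith
    calc (1 : ℝ) = Real.log (Real.exp 1) := (Real.log_exp 1).symm
      _ ≤ Real.log 4 := Real.log_le_log (Real.exp_pos 1) h4
  have hU1 : U ≤ 1 := hUle.trans (min_le_left _ _)
  have hUk : U ≤ klCurveKappa / (24 * (R.Gfr 0 + R.Gfr 1 + 1)) := hUle.trans (min_le_right _ _)
  rw [abs_of_pos hU]
  have hU2 : U ^ 2 ≤ U := by nlinarith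
  have hA : 2 * R.Gfr 0 * U + 2 * R.Gfr 1 * U ^ 2 ≤ 2 * (R.Gfr 0 + R.Gfr 1 + 1) * U := by nlinarith
  have hB : 2 * (R.Gfr 0 + R.Gfr 1 + 1) * U ≤ klCurveKappa / 12 := by
    have hpos : 0 < 24 * (R.Gfr 0 + R.Gfr 1 + 1) := by positivity
    have := (le_div_iff₀ hpos).mp hUk
    linarith
  have hC : R.Gfr 2 * (c / Real.log 4) ≤ R.Gfr 2 * c := mul_le_mul_of_nonneg_left (div_le_self hc hlog) h2
  have hD : R.Gfr 2 * c ≤ klCurveKappa / 12 := by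
    have hpos : 0 < 12 * (R.Gfr 2 + 1) := by positivity
    have := (le_div_iff₀ hpos).mp (show c ≤ klCurveKappa / (12 * (R.Gfr 2 + 1)) from hcle)
    nlinarith
  linarith

/-! ## §3 The frame data and the graded curve constant, explicit thresholds -/

/-- **`frame_sizes_of_frameOK` with the thresholds NAMED**: for `0 < c ≤ klCurveC3 R`, `0 < U ≤ klCurveU0 R`, `klBetaMin ≤ β ≤ e^{c/U²}`,
`μ ∈ klWindowC` and `FrameOK R U (nScales β) μ K`: the `C²` size `A ≤ 1/20`, `2A < Dt_min`, `Dt_min/2 ≤ Dt_min − 2A`, the window margins,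
and the sharp order-3/4 sizes. -/
theorem frame_sizes_of_frameOK_explicit {R : RenConsts} (hR : ∀ j, 0 ≤ R.Gfr j) {c : ℝ} (hc : 0 < c) (hcle : c ≤ klCurveC3 R)
    {U : ℝ} (hU : 0 < U) (hUle : U ≤ klCurveU0 R) {β : ℝ} (hβmin : klBetaMin ≤ β) (hβc : β ≤ Real.exp (c / U ^ 2))
    {μ : ℝ} (hμ : μ ∈ klWindowC) {K : TrigPolyC4v} (hK : FrameOK R U (nScales β) μ K) :
    (∀ p : Momentum, ∀ j ≤ 2, ‖iteratedFDeriv ℝ j (frameShift K) p‖ ≤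
        2 * R.Gfr 0 * |U| + 2 * R.Gfr 1 * U ^ 2 + R.Gfr 2 * (c / Real.log 4)) ∧
    2 * R.Gfr 0 * |U| + 2 * R.Gfr 1 * U ^ 2 + R.Gfr 2 * (c / Real.log 4) ≤ 1 / 20 ∧
    2 * (2 * R.Gfr 0 * |U| + 2 * R.Gfr 1 * U ^ 2 + R.Gfr 2 * (c / Real.log 4)) <
      (bandBounds (show (-4 : ℝ) < -1.1 by norm_num) (show (-1.1 : ℝ) ≤ -0.1 by norm_num) (show (-0.1 : ℝ) < 0 by norm_num)).Dtmin ∧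
    klCurveD ≤ (bandBounds (show (-4 : ℝ) < -1.1 by norm_num) (show (-1.1 : ℝ) ≤ -0.1 by norm_num)
        (show (-0.1 : ℝ) < 0 by norm_num)).Dtmin - 2 * (2 * R.Gfr 0 * |U| + 2 * R.Gfr 1 * U ^ 2 + R.Gfr 2 * (c / Real.log 4)) ∧
    ((-1.1 : ℝ) ≤ μ - (2 * R.Gfr 0 * |U| + 2 * R.Gfr 1 * U ^ 2 + R.Gfr 2 * (c / Real.log 4)) ∧
      μ + (2 * R.Gfr 0 * |U| + 2 * R.Gfr 1 * U ^ 2 + R.Gfr 2 * (c / Real.log 4)) ≤ -0.1) ∧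
    (∀ p : Momentum, ‖iteratedFDeriv ℝ 3 (frameShift K) p‖ ≤ R.Gfr 3 * U ^ 2 * ((4 : ℝ) ^ (nScales β + 1) / 3)) ∧
    (∀ p : Momentum, ‖iteratedFDeriv ℝ 4 (frameShift K) p‖ ≤ R.Gfr 4 * U ^ 2 * ((16 : ℝ) ^ (nScales β + 1) / 15)) := by
  have ha : (-4 : ℝ) < -1.1 := by norm_num
  have hab : (-1.1 : ℝ) ≤ -0.1 := by norm_num
  have hb : (-0.1 : ℝ) < 0 := by norm_num
  have hBD : (bandBounds ha hab hb).Dtmin = cDtmin (-1.1) (-0.1) := rfl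
  have hAf : ∀ p : Momentum, ∀ j ≤ 2, ‖iteratedFDeriv ℝ j (frameShift K) p‖ ≤
      2 * R.Gfr 0 * |U| + 2 * R.Gfr 1 * U ^ 2 + R.Gfr 2 * (c / Real.log 4) := fun p j hj =>
    norm_iteratedFDeriv_frameShift_le_of_frameOK_regime hR hc.le hβmin hβc hK p hj
  set A := 2 * R.Gfr 0 * |U| + 2 * R.Gfr 1 * U ^ 2 + R.Gfr 2 * (c / Real.log 4) with hAdef
  have h4A : 4 * A ≤ klCurveKappa := frame_thresholds_explicit hR hc.le hcle hU hUle
  have hA0 : 0 ≤ A := le_trans (norm_nonneg _) (hAf 0 0 (by norm_num))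
  have hκ1 := klCurveKappa_le_cDtmin
  have hκ2 := klCurveKappa_le_fifth
  have hDt := cDtmin_window_pos
  have hA20 : A ≤ 1 / 20 := by linarith
  have hADt : 2 * A < (bandBounds ha hab hb).Dtmin := by rw [hBD]; linarith
  have hhalf : klCurveD ≤ (bandBounds ha hab hb).Dtmin - 2 * A := by rw [hBD]; unfold klCurveD; linarith
  obtain ⟨hlo, hhi⟩ := klWindowC_margin hμ hA20
  have hU2 : uPow 3 U = U ^ 2 := uPow_succ 2 U
  have hU2' : uPow 4 U = U ^ 2 := uPow_succ 3 U
  have h3 : ∀ p : Momentum, ‖iteratedFDeriv ℝ 3 (frameShift K) p‖ ≤ R.Gfr 3 * U ^ 2 * ((4 : ℝ) ^ (nScales β + 1) / 3) := by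
    intro p
    refine (norm_iteratedFDeriv_frameShift_le_sum_of_frameOK hK p (by norm_num)).trans ?_
    rw [← Finset.mul_sum, hU2]
    exact mul_le_mul_of_nonneg_left (sum_four_zpow_order_three_le _) (mul_nonneg (hR 3) (sq_nonneg U))
  have h4 : ∀ p : Momentum, ‖iteratedFDeriv ℝ 4 (frameShift K) p‖ ≤ R.Gfr 4 * U ^ 2 * ((16 : ℝ) ^ (nScales β + 1) / 15) := by
    intro p
    refine (norm_iteratedFDeriv_frameShift_le_sum_of_frameOK hK p le_rfl).trans ?_
    rw [← Finset.mul_sum, hU2']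
    exact mul_le_mul_of_nonneg_left (sum_four_zpow_order_four_le _) (mul_nonneg (hR 4) (sq_nonneg U))
  exact ⟨hAf, hA20, hADt, hhalf, ⟨hlo, hhi⟩, h3, h4⟩

/-- **The graded curve constant, explicit**: for `0 < c ≤ klCurveC3 R`, `0 < U ≤ klCurveU0 R`, `klBetaMin ≤ β ≤ e^{c/U²}`, `μ ∈ klWindowC`
and every admissible frame `FrameOK R U (nScales β) μ K`, the Fermi-point map `θ ↦ toLp 2 (k_F^K θ)` is `C⁴` and
`‖Dⁱ(toLp ∘ k_F^K)(θ)‖ ≤ (klCurveC0 R · 2^{nScales β+1})ⁱ` for `1 ≤ i ≤ 4` and every `θ` (the proof of p480072 with named witnesses).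
[cite: BenfattoGiulianiMastropietro2006, §2.4 Lemma 2.1 (2.40)] -/
theorem fermiPointLp_graded_of_frameOK_explicit {R : RenConsts} (hR : ∀ j, 0 ≤ R.Gfr j) {c : ℝ} (hc : 0 < c) (hcle : c ≤ klCurveC3 R)
    {U : ℝ} (hU : 0 < U) (hUle : U ≤ klCurveU0 R) {β : ℝ} (hβmin : klBetaMin ≤ β) (hβc : β ≤ Real.exp (c / U ^ 2))
    {μ : ℝ} (hμ : μ ∈ klWindowC) {K : TrigPolyC4v} (hK : FrameOK R U (nScales β) μ K) :
    ContDiff ℝ 4 (fun θ : ℝ => (WithLp.toLp 2 (klFermiPoint μ K θ) : Momentum)) ∧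
      ∀ i : ℕ, 1 ≤ i → i ≤ 4 → ∀ θ : ℝ,
        ‖iteratedFDeriv ℝ i (fun θ : ℝ => (WithLp.toLp 2 (klFermiPoint μ K θ) : Momentum)) θ‖ ≤
          (klCurveC0 R * (2 : ℝ) ^ (nScales β + 1)) ^ i := by
  have ha : (-4 : ℝ) < -1.1 := by norm_num
  have hab : (-1.1 : ℝ) ≤ -0.1 := by norm_num
  have hb : (-0.1 : ℝ) < 0 := by norm_num
  set B := bandBounds ha hab hb with hBdef
  have hG3 := hR 3; have hG4 := hR 4
  obtain ⟨hAf, hA20, hADt, hhalf, ⟨hlo, hhi⟩, hA3f, hA4f⟩ := frame_sizes_of_frameOK_explicit hR hc hcle hU hUle hβmin hβc hμ hK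
  refine ⟨contDiff_four_fermiPointLp B hAf hADt hlo hhi, ?_⟩
  intro i hi1 hi4 θ
  set A := 2 * R.Gfr 0 * |U| + 2 * R.Gfr 1 * U ^ 2 + R.Gfr 2 * (c / Real.log 4) with hAdef
  set d := klCurveD with hd
  have hdpos : 0 < d := klCurveD_pos
  set s := π * Real.sqrt 2 with hs
  have hs0 : 0 < s := by positivity
  set r₁ := klCurveR1 with hr₁
  have hr₁0 : 0 ≤ r₁ := klCurveR1_nonneg
  set r₂ := klCurveR2 with hr₂
  have hr₂0 : 0 ≤ r₂ := klCurveR2_nonneg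
  set r₃ := klCurveR3 R with hr₃
  have hr₃0 : 0 ≤ r₃ := klCurveR3_nonneg hR
  set r₄ := klCurveR4 R with hr₄
  set C := max 1 (max r₁ (max r₂ (max r₃ r₄))) with hC
  have hC1 : 1 ≤ C := le_max_left _ _
  have hCr₁ : r₁ ≤ C := le_trans (le_max_left _ _) (le_max_right _ _)
  have hCr₂ : r₂ ≤ C := le_trans (le_trans (le_max_left _ _) (le_max_right _ _)) (le_max_right _ _)
  have hCr₃ : r₃ ≤ C := le_trans (le_trans (le_trans (le_max_left _ _) (le_max_right _ _)) (le_max_right _ _)) (le_max_right _ _)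
  have hCr₄ : r₄ ≤ C :=
    le_trans (le_trans (le_trans (le_max_right _ _) (le_max_right _ _)) (le_max_right _ _)) (le_max_right _ _)
  have hC0 : klCurveC0 R = 20 * C := rfl
  have hU1 : U ≤ 1 := hUle.trans (klCurveU0_le_one R)
  obtain ⟨P, hP⟩ : ∃ P : ℝ, P = (4 : ℝ) ^ (nScales β + 1) := ⟨_, rfl⟩
  obtain ⟨Q, hQ⟩ : ∃ Q : ℝ, Q = (16 : ℝ) ^ (nScales β + 1) := ⟨_, rfl⟩
  have hP1 : 1 ≤ P := by rw [hP]; exact one_le_pow₀ (by norm_num)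
  have hPQ : P ≤ Q := by rw [hP, hQ]; exact pow_le_pow_left₀ (by norm_num) (by norm_num) _
  have hP0 : (0 : ℝ) ≤ P := zero_le_one.trans hP1
  obtain ⟨A₃, hA₃⟩ : ∃ A₃ : ℝ, A₃ = R.Gfr 3 * U ^ 2 * (P / 3) := ⟨_, rfl⟩
  obtain ⟨A₄, hA₄⟩ : ∃ A₄ : ℝ, A₄ = R.Gfr 4 * U ^ 2 * (Q / 15) := ⟨_, rfl⟩
  have hA3f' : ∀ p : Momentum, ‖iteratedFDeriv ℝ 3 (frameShift K) p‖ ≤ A₃ := by rw [hA₃, hP]; exact hA3f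
  have hA4f' : ∀ p : Momentum, ‖iteratedFDeriv ℝ 4 (frameShift K) p‖ ≤ A₄ := by rw [hA₄, hQ]; exact hA4f
  have hU2 : U ^ 2 ≤ 1 := by nlinarith only [hU1, hU]
  have hA₃le : A₃ ≤ R.Gfr 3 * P := by
    have h1 : U ^ 2 * (P / 3) ≤ P := by nlinarith only [hU2, hP0, sq_nonneg U]
    rw [hA₃, mul_assoc]; exact mul_le_mul_of_nonneg_left h1 hG3
  have hA₄le : A₄ ≤ R.Gfr 4 * Q := by
    have hQ0 : (0 : ℝ) ≤ Q := hP0.trans hPQ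
    have h1 : U ^ 2 * (Q / 15) ≤ Q := by nlinarith only [hU2, hQ0, sq_nonneg U]
    rw [hA₄, mul_assoc]; exact mul_le_mul_of_nonneg_left h1 hG4
  have hden : d ≤ B.Dtmin - 2 * A := hhalf
  have hdenpos : 0 < B.Dtmin - 2 * A := hdpos.trans_le hden
  -- order 1
  have hR₁ : |deriv (perturbedFermiRadius (fun p : Fin 2 → ℝ => -K.eval p) μ) θ| ≤ r₁ := by
    have h := abs_deriv_frameRadius_le_uniform B hAf hADt hlo hhi θ
    refine h.trans ?_
    rw [hr₁]; unfold klCurveR1; rw [← hd]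
    exact div_relax (mul_le_mul_of_nonneg_right (by linarith only [hA20]) hs0.le) (by positivity) hdpos hden
  -- order 2
  have hR₂ : |deriv (deriv (perturbedFermiRadius (fun p : Fin 2 → ℝ => -K.eval p) μ)) θ| ≤ r₂ := by
    have h := abs_deriv_two_frameRadius_le B hAf hADt hlo hhi hR₁
    refine h.trans ?_
    rw [hr₂]; unfold klCurveR2; rw [← hr₁, ← hd]
    have hK : 0 ≤ (r₁ + s) ^ 2 := sq_nonneg _
    have hL : 0 ≤ 2 * r₁ + s := by positivity
    exact div_relax (add_le_add (mul_le_mul_of_nonneg_right (by linarith only [hA20]) hK)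
      (mul_le_mul_of_nonneg_right (by linarith only [hA20]) hL)) (by positivity) hdpos hden
  -- order 3: `R₃ ≤ r₃·P`
  have hR₃ : |deriv (deriv (deriv (perturbedFermiRadius (fun p : Fin 2 → ℝ => -K.eval p) μ))) θ| ≤ r₃ * P := by
    have h := abs_deriv_three_frameRadius_le B hAf hADt hlo hhi hA3f' hR₁ hR₂
    refine h.trans ?_
    have hnum := num_three_le hA20 hA₃le hP1 hr₁0 hr₂0 hs0.le
    refine (div_relax hnum (by positivity) hdpos hden).trans (le_of_eq ?_)
    rw [hr₃]; unfold klCurveR3; rw [← hr₁, ← hr₂, ← hd]; ring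
  -- order 4: `R₄ ≤ r₄·Q`
  have hR₄ : |deriv (deriv (deriv (deriv (perturbedFermiRadius (fun p : Fin 2 → ℝ => -K.eval p) μ)))) θ| ≤ r₄ * Q := by
    have h := abs_deriv_four_frameRadius_le B hAf hADt hlo hhi hA3f' hA4f' hR₁ hR₂ hR₃
    refine h.trans ?_
    have hnum := num_four_le hA20 hA₃le hA₄le hG3 hP1 hPQ hr₁0 hr₂0 hr₃0 hs0.le
    have hQ0 : (0 : ℝ) ≤ Q := hP0.trans hPQ
    refine (div_relax hnum (by positivity) hdpos hden).trans (le_of_eq ?_)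
    rw [hr₄]; unfold klCurveR4; rw [← hr₁, ← hr₂, ← hr₃, ← hd]; ring
  -- the graded constant `D = C·2^{N+1}`
  obtain ⟨h4, h16, h48⟩ := pow_two_pow_facts (nScales β)
  obtain ⟨T, hT⟩ : ∃ T : ℝ, T = (2 : ℝ) ^ (nScales β + 1) := ⟨_, rfl⟩
  have hT1 : 1 ≤ T := by rw [hT]; exact one_le_pow₀ (by norm_num)
  have hPT : P ≤ T ^ 3 := by rw [hP, hT]; exact h48
  have hQT : Q = T ^ 4 := by rw [hQ, hT]; exact h16
  obtain ⟨hD1, g1, g2, g3, g4⟩ := graded_consts hC1 hCr₁ hCr₂ hCr₃ hCr₄ hT1 hP0 hPT hQT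
  have h := norm_iteratedFDeriv_fermiPointLp_le_of_tower B hAf hADt hlo hhi hD1 hR₁ hR₂ hR₃ hR₄ g1 g2 g3 g4 hi1 hi4
  calc _ ≤ (20 * (C * T)) ^ i := h
    _ = (klCurveC0 R * (2 : ℝ) ^ (nScales β + 1)) ^ i := by rw [hC0, hT]; ring

/-! ## §4 (E3g) with explicit thresholds: no `∃` left -/

section Model

variable {L M : ℕ} [NeZero L] [NeZero M]

/-- **(E3g) FROM GRADED SIZES, EXPLICIT THRESHOLDS.**  For `R.WF`, `Mtot ≥ 0`, `0 < c ≤ klCurveC3 R`, `0 < U ≤ klAngU0 R Mtot`,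
`klBetaMin ≤ β ≤ e^{c/U²}`, `μ ∈ klWindowC`, an admissible frame `FrameOK R U (nScales β) μ K`, well-formed `G, Q` and a scale `n`:
graded momentum sizes `‖Dᵏ evalM D_n(K)‖ ≤ Mtot·U²·2^{k(nScales β+1)}` (`1 ≤ k ≤ 4`) ⟹ `TwoLegAngularG L M G Q R β U μ K n`. -/
theorem twoLegAngularG_of_graded_sizes_explicit {R : RenConsts} (hR : R.WF) {Mtot : ℝ} (hMtot : 0 ≤ Mtot)
    {c : ℝ} (hc : 0 < c) (hcle : c ≤ klCurveC3 R) {U : ℝ} (hU : 0 < U) (hUle : U ≤ klAngU0 R Mtot)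
    {β : ℝ} (hβmin : klBetaMin ≤ β) (hβc : β ≤ Real.exp (c / U ^ 2)) {μ : ℝ} (hμ : μ ∈ klWindowC)
    {K : TrigPolyC4v} (hK : FrameOK R U (nScales β) μ K) {G : GeoConsts} {Q : EngConsts} (hG : G.WF) (hQ : Q.WF) {n : ℕ}
    (hm : ∀ k, 1 ≤ k → k ≤ 4 → ∀ q : Momentum,
      ‖iteratedFDeriv ℝ k (evalM (klTwoLegPoly L M β U μ K n)) q‖ ≤ Mtot * U ^ 2 * (2 : ℝ) ^ (k * (nScales β + 1))) :
    TwoLegAngularG L M G Q R β U μ K n := by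
  have hGfr : ∀ j, 0 ≤ R.Gfr j := hR.2.2
  have hUle' : U ≤ klCurveU0 R := hUle.trans (klAngU0_le_klCurveU0 R Mtot)
  obtain ⟨hγ, hcurve⟩ := fermiPointLp_graded_of_frameOK_explicit hGfr hc hcle hU hUle' hβmin hβc hμ hK
  have hD : ∀ i, 1 ≤ i → i ≤ 4 → ∀ θ : ℝ,
      ‖iteratedDeriv i (fun θ : ℝ => (WithLp.toLp 2 (klFermiPoint μ K θ) : Momentum)) θ‖ ≤
        (klCurveC0 R * (2 : ℝ) ^ (nScales β + 1)) ^ i := by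
    intro i hi1 hi4 θ
    rw [← norm_iteratedFDeriv_eq_norm_iteratedDeriv]
    exact hcurve i hi1 hi4 θ
  exact twoLegAngularG_of_graded_sizes_and_curve (m := fun k => Mtot * U ^ 2 * (2 : ℝ) ^ (k * (nScales β + 1))) hm hγ hD
    fun j hj1 hj4 => graded_fit_angBar hG hQ hR hU (one_le_klCurveC0 R) hMtot (smallness_of_le_klAngU0 hMtot hUle)
      (nScales β) (fun k _ _ => le_rfl) hj1 hj4

/-- **(E3g) FROM GRADED MOMENTS, EXPLICIT THRESHOLDS** (the (M1) interface): same hypotheses with the coefficient moments of the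
scale-`n` two-leg data `≤ Mtot·U²·2^{k(nScales β+1)}` (`1 ≤ k ≤ 4`) ⟹ `TwoLegAngularG L M G Q R β U μ K n`. -/
theorem twoLegAngularG_of_graded_moments_explicit {R : RenConsts} (hR : R.WF) {Mtot : ℝ} (hMtot : 0 ≤ Mtot)
    {c : ℝ} (hc : 0 < c) (hcle : c ≤ klCurveC3 R) {U : ℝ} (hU : 0 < U) (hUle : U ≤ klAngU0 R Mtot)
    {β : ℝ} (hβmin : klBetaMin ≤ β) (hβc : β ≤ Real.exp (c / U ^ 2)) {μ : ℝ} (hμ : μ ∈ klWindowC)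
    {K : TrigPolyC4v} (hK : FrameOK R U (nScales β) μ K) {G : GeoConsts} {Q : EngConsts} (hG : G.WF) (hQ : Q.WF) {n : ℕ}
    (hm : ∀ k, 1 ≤ k → k ≤ 4 → ∑ x : TorusSite 2 L, (1 + (x 0).valMinAbs.natAbs + (x 1).valMinAbs.natAbs : ℝ) ^ k *
      |torusCosCoeff L (klLocSelfEnergyRe L M β U μ K n) x| ≤ Mtot * U ^ 2 * (2 : ℝ) ^ (k * (nScales β + 1))) :
    TwoLegAngularG L M G Q R β U μ K n :=
  twoLegAngularG_of_graded_sizes_explicit hR hMtot hc hcle hU hUle hβmin hβc hμ hK hG hQ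
    fun k hk1 hk4 q => norm_iteratedFDeriv_evalM_klTwoLegPoly_le_of_moments (hm k hk1 hk4) q

end Model

end Summit.HubbardSuperconductivity.HubbardSuperconductivity.Theorems.PerturbedFermiCurve

end
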